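import Summits.BirchSwinnertonDyer.BirchSwinnertonDyer.Theses.TeichmullerTwistDescent
import Summits.BirchSwinnertonDyer.BirchSwinnertonDyer.Theorems.TeichmullerTwistDescentCells57Residual
import HarnessLib

/-!
# Route `TeichmullerTwistDescent`, support item `PrincipalSeriesOptimalManinUnitOfCells`
# (stmt-BirchSwinnertonDyer-23886): PSMU GRANTED the PUB bundles and the two cells GE11 / CORNER — closed by name

Cell `pub/bsd-wall` (D-0145 lines of planner bsd-idea-3; route `TeichmullerTwistDescent` rev 2, 67d75d08), seat
`bsd-line-edix-p1` (prover, g2; cc'd on idea-crit-5's verdict #5 of the re-glue). The rev-2 re-glue files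
`PrincipalSeriesOptimalManinUnitOfCells := KatoNeronAndCremonaFacts → PublishedManinFacts → PublishedInputsAdditiveKoly →
OrdinaryLowValuationOptimalManinUnitGeEleven → KummerCornerTorsionOptimalManinUnit → PrincipalSeriesOptimalManinUnit`,
consumed by `closes`: PSMU (stmt-BirchSwinnertonDyer-22638, Manin's `p`-part on the principal-series = (G)-ordinary
classes) GRANTED the PUB bundle (F″ = `kato_neron_isIntegral_twistedSymbolSum_of_additive_five_le` ∧ Cremona), the
Manin-facts bundle (2nd conjunct = Edixhoven's Kodaira-type reading, `p > 7`), the Kolyvagin-inputs bundle (6th conjunct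
= modularity `exists_isNewformOf`), the `p ≥ 11` low-valuation cell GE11 (stmt-BirchSwinnertonDyer-23885) and the
Kummer-corner cell CORNER (stmt-BirchSwinnertonDyer-23883: III@5 / II@7, (G)-ordinary, with a `ℚ_p`-rational point of
order `p`). It is exactly the item form of the landed cell theorem
`TeichmullerTwistDescent.principalSeriesOptimalManinUnit_of_cellPS11_of_kato57_of_corner`
(`Theorems/TeichmullerTwistDescentCells57Residual.lean`, seat bsd-line-ttd-p2). HONEST STATUS: this closes the SUPPORT
item by name; PSMU itself stays conditional on F″, on GE11 and on CORNER. BSD is not proved by any of this.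
-/

set_option autoImplicit false
-- the Theorems namespace of this sub repeats the summit name by design (D-0017 nested layout)
set_option linter.dupNamespace false

namespace Summit.BirchSwinnertonDyer.BirchSwinnertonDyer.Theorems

/-- **`PrincipalSeriesOptimalManinUnitOfCells` (stmt-BirchSwinnertonDyer-23886) holds**: GRANTED `KatoNeronAndCremonaFacts`
(F″ ∧ Cremona), `PublishedManinFacts` (Edixhoven's Kodaira reading), `PublishedInputsAdditiveKoly` (modularity), the
cell GE11 and the cell CORNER, the crux PSMU `PrincipalSeriesOptimalManinUnit` — by
`TeichmullerTwistDescent.principalSeriesOptimalManinUnit_of_cellPS11_of_kato57_of_corner`.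
[cite: EdixhovenManin1991, Thm. 3] [cite: Kato2004Asterisque, (8.1.3) (p. 180), Thm. 9.7 (p. 189)]
[cite: Mazur1977, Ch. III §5, Step 1, p. 158] -/
theorem principalSeriesOptimalManinUnitOfCells_proof :
    Summit.BirchSwinnertonDyer.BirchSwinnertonDyer.Theses.TeichmullerTwistDescent.PrincipalSeriesOptimalManinUnitOfCells := by
  unfold Summit.BirchSwinnertonDyer.BirchSwinnertonDyer.Theses.TeichmullerTwistDescent.PrincipalSeriesOptimalManinUnitOfCells
  intro hK hF hP h11 hc
  exact TeichmullerTwistDescent.principalSeriesOptimalManinUnit_of_cellPS11_of_kato57_of_corner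
    hF.2.1 hP.2.2.2.2.2.1 hK.1 h11 hc

end Summit.BirchSwinnertonDyer.BirchSwinnertonDyer.Theorems
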